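import Mathlib
import Literature.Combinatorics.Optimization.PatternMatrixRankUpperBounds
import Literature.Combinatorics.Optimization.UdisjShiftNonnegativeRank

/-!
# SingleBlock39 — one block of the located permutahedron pencil is easy:
# `rank₊ M̄_{λ,k}^{(n)} ≤ 2n² + n + 1 + (k+1)·2^{h(h+2)}`, `h = ⌈1/λ⌉ − 1`
# (crux `FifoMatching.NNDivisionHard`, stmt-ValiantsHypothesis-21181; W7 S2 lane, val-idea-39 g7)

S2 census object (memo `AsymmetricWindow39.md` §2′, kernel `AsymmetricWindow39.lean` REV 4 §5 `Quotient`): the reduced matrix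
`M̄_{λ,k}(A,B) = (1 − |A∩B|)² + λ·(ΣA − k(k−1)/2)` on `C([n],k) × 2^{[n]}` — the block `π = id` of the `k`-slice of the pencil
`M_λ[a;(b,π)] = (1 − |a∩b|)² + λ·inv(a;π)` (`pencil_block_one`), of which the slice is the `S_n`-unfolding (`pencil_quotient`).
The memo's pointer LL-1(M̄) (§2′ R1; census S2-LL (γ)) asked for `rank₊ M̄_{λ,k} ≥ n^{c·min(k,1/λ)}`.

THIS FILE refutes that pointer with an EXPLICIT nonnegative factorisation whose size has `n`-exponent 2 for every fixed `λ > 0`: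

★ `pencilBar_hasNonnegFactorization : 0 < λ → 1 ≤ λ(h+1) →
     HasNonnegFactorization (k-slice of M̄_{λ,k}) (2n² + n + 1 + (k+1)·2^{h(h+2)})`.

THE CERTIFICATE (§1–§4).  Write `holes_A(p) = #{q < p : q ∉ A}`; then `ΣA − k(k−1)/2 = Σ_{p∈A} holes_A(p)` (`pedestal_eq`).
`LOW(A) = {p ∈ A : λ·holes_A(p) < 1}` (an initial segment of `A`), `HIGH = A ∖ LOW`, `runs(LOW)` = maximal intervals of `LOW`,
`G = #runs`.  For EVERY row (`rowIdentity`):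
  `M̄(A,B) = c_A + Σ_{[i,j] ∈ runs(LOW)} (1 − |B∩[i,j]|)² + #{(p,q) ∈ (A∩B)², p ≠ q, not in one run of LOW} + #{p ∈ HIGH : p ∉ B}`,
  `c_A = λ·Σ_A holes + 1 − G − |HIGH|`.
REGULAR rows (`c_A ≥ 0`) are therefore in the cone of the `2n² + n + 1` UNIVERSAL columns `1`, `(1 − |B∩[i,j]|)²`, `[p,q ∈ B]`, `[p ∉ B]`.
IRREGULAR rows use `M̄(A,B) = (λ·Σ_HIGH holes − |HIGH|) + Y(LOW,B) + #{(p,q): not both LOW} + #{p ∈ HIGH ∖ B}` with the private column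
`Y(P,B) = (1 − |P∩B|)² + λ·Σ_P holes_P ≥ 0`, and an irregular LOW-pattern is `[0,m) ⊔ (m+1+Q)` with `m ≤ k`, `Q ⊆ [0, h(h+2))`
(`irregular_pattern`): at most `(k+1)·2^{h(h+2)}` private columns, independent of `n`.

REV 2 (§7, the OTHER SIDE of the `n`-free term): ONE BLOCK SEES `UDISJ` — the rows `[0,f) ∪ {f+2i+[i∈a]} ∪ {f+2m+2i+[i∉a]}`
(`a ⊆ [m]`, `k = f + 2m`) have constant pedestal `2m²` and meet the columns `{f+2i+1 : i ∈ b}` in `|a ∩ b|` points, so the slice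
contains the `ρ`-extension `(1 − |a∩b|)² + 2λm²` of `UDISJ_m` and the tree's discharged BFPS 2012 Theorem 5 gives
★★ `singleBlock_visible : 2m ≤ k → k + 2m ≤ n → 4j+3 ≤ m → 0 ≤ λ → λm² ≤ 1/2 →
     HasNonnegFactorization (k-slice of M̄_{λ,k}) N → e^{(j+1)/576} ≤ 64(j+1)·N`,
i.e. `rank₊ M̄_{λ,k} ≥ 2^{Ω(min(k, n−k, λ^{−1/2}))}`: one block costs `Θ(n²)` plus an `n`-FREE term lying between `2^{Ω(√h)}` and
`(k+1)·2^{h(h+2)}` (`h ≍ 1/λ`); which power of `h` is the truth is open.  (Asymptotic statement: the constants are BFPS-grade,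
the bound exceeds `1` only for `j ≳ 6·10³`.)

CONSEQUENCES (memo rev 5 §2″): a single block has `n`-exponent exactly 2 (rank `≥ C(n,2)` from the pair coefficients, paper), so the
S2 window of the PENCIL is a pure `S_n`-gluing question — covariant gluing costs `n^{Θ(min(n,1/λ))}` (T4 `pencil_symm_lower/upper`),
general gluing is open in `[max(C(n,2), T3), (n+1)^{O(1/λ)}]`.  Negative/calibration lane; nothing closes; 21181 OPEN; VP ≠ VNP NOT proved.
`pencilBar` below is VERBATIM the `pencilBar` of `AsymmetricWindow39.lean` §5 (that module is not importable here).
-/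

set_option linter.dupNamespace false
set_option linter.unusedVariables false
set_option linter.unusedSectionVars false

namespace Summit.ValiantsHypothesis.ValiantsHypothesis.Cruxes.NNDivisionHard.SingleBlock39

open Finset

noncomputable section

/-! ## §0  The object -/

/-- **The reduced matrix `M̄_{λ,k}`** on positions: `(1 − |A∩B|)² + λ·(ΣA − k(k−1)/2)` (verbatim `AsymmetricWindow39.pencilBar`). -/
noncomputable def pencilBar (n : ℕ) (lam : ℝ) (k : ℕ) (A B : Finset (Fin n)) : ℝ :=
  (1 - ((A ∩ B).card : ℝ)) ^ 2 + lam * ((∑ p ∈ A, ((p : ℕ) : ℝ)) - (k : ℝ) * (k - 1) / 2)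

/-- the `k`-slice of `M̄_{λ,k}` as a matrix: rows `{A ⊆ [n] // |A| = k}`, columns `B ⊆ [n]`. -/
def pencilBarSlice (n : ℕ) (lam : ℝ) (k : ℕ) (A : {A : Finset (Fin n) // A.card = k}) (B : Finset (Fin n)) : ℝ :=
  pencilBar n lam k A.1 B

/-! ## §1  Holes, the pedestal, LOW / HIGH -/

/-- `holes P p = #{q < p : q ∉ P}`. -/
def holes (P : Finset ℕ) (p : ℕ) : ℕ := ((range p).filter (fun q => q ∉ P)).card

/-- `below P p = #{q < p : q ∈ P}`. -/
def below (P : Finset ℕ) (p : ℕ) : ℕ := ((range p).filter (fun q => q ∈ P)).card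

theorem below_add_holes (P : Finset ℕ) (p : ℕ) : below P p + holes P p = p := by
  unfold below holes
  rw [card_filter_add_card_filter_not, card_range]

theorem below_insert_top {a : ℕ} {s : Finset ℕ} (hs : ∀ x ∈ s, x < a) : below (insert a s) a = s.card := by
  unfold below
  congr 1
  ext q
  simp only [mem_filter, mem_range, mem_insert]
  constructor
  · rintro ⟨hq, rfl | h⟩
    · exact absurd hq (lt_irrefl _)
    · exact h
  · intro h
    exact ⟨hs q h, Or.inr h⟩

theorem below_insert_of_lt {a p : ℕ} {s : Finset ℕ} (hp : p < a) : below (insert a s) p = below s p := by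
  unfold below
  congr 1
  ext q
  simp only [mem_filter, mem_range, mem_insert]
  constructor
  · rintro ⟨hq, rfl | h⟩
    · exact absurd (hq.trans hp) (lt_irrefl _)
    · exact ⟨hq, h⟩
  · rintro ⟨hq, h⟩
    exact ⟨hq, Or.inr h⟩

/-- `2·Σ_{p∈P} below_P(p) = |P|(|P|−1)`: the ranks `0,…,|P|−1` summed. -/
theorem two_mul_sum_below (P : Finset ℕ) : 2 * ∑ p ∈ P, below P p = P.card * (P.card - 1) := by
  induction P using Finset.induction_on_max with
  | empty => simp
  | insert a s hs ih =>
    have ha : a ∉ s := fun h => lt_irrefl a (hs a h)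
    rw [sum_insert ha, below_insert_top hs, card_insert_of_notMem ha,
      sum_congr rfl fun p hp => below_insert_of_lt (hs p hp), mul_add, ih]
    rcases Nat.eq_zero_or_pos s.card with h | h
    · rw [h]
    · obtain ⟨c, hc⟩ : ∃ c, s.card = c + 1 := ⟨s.card - 1, by omega⟩
      rw [hc]
      simp only [Nat.add_sub_cancel]
      ring

/-- **The pedestal is the hole count:** `ΣP − |P|(|P|−1)/2 = Σ_{p∈P} holes_P(p)`. -/
theorem pedestal_eq (P : Finset ℕ) :
    (∑ p ∈ P, (p : ℝ)) - (P.card : ℝ) * (P.card - 1) / 2 = ∑ p ∈ P, (holes P p : ℝ) := by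
  have h1 : ∀ p ∈ P, (p : ℝ) = (below P p : ℝ) + (holes P p : ℝ) := fun p _ => by
    rw [← Nat.cast_add, below_add_holes]
  have h2 := two_mul_sum_below P
  rw [sum_congr rfl h1, sum_add_distrib]
  have h3 : (2 : ℝ) * (∑ p ∈ P, (below P p : ℝ)) = (P.card : ℝ) * (P.card - 1) := by
    rcases Nat.eq_zero_or_pos P.card with h | h
    · rw [Finset.card_eq_zero.mp h]; simp
    · have : ((P.card * (P.card - 1) : ℕ) : ℝ) = (P.card : ℝ) * (P.card - 1) := by
        rw [Nat.cast_mul, Nat.cast_sub h]; simp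
      rw [← this, ← h2]; push_cast; ring
  linarith

theorem holes_mono (P : Finset ℕ) {q p : ℕ} (hqp : q ≤ p) : holes P q ≤ holes P p := by
  unfold holes
  exact card_le_card (fun x hx => by
    simp only [mem_filter, mem_range] at hx ⊢; exact ⟨lt_of_lt_of_le hx.1 hqp, hx.2⟩)

/-- a hole `m < p` forces `holes_P(p) ≥ 1`. -/
theorem one_le_holes {P : Finset ℕ} {m p : ℕ} (hm : m ∉ P) (hmp : m < p) : 1 ≤ holes P p := by
  unfold holes
  exact card_pos.mpr ⟨m, by simp [mem_filter, hmp, hm]⟩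

variable (lam : ℝ)

/-- `LOW(P) = {p ∈ P : λ·holes_P(p) < 1}`. -/
def low (P : Finset ℕ) : Finset ℕ := P.filter (fun p => lam * (holes P p : ℝ) < 1)

/-- `HIGH(P) = {p ∈ P : ¬ λ·holes_P(p) < 1}`. -/
def high (P : Finset ℕ) : Finset ℕ := P.filter (fun p => ¬ lam * (holes P p : ℝ) < 1)

theorem low_subset (P : Finset ℕ) : low lam P ⊆ P := filter_subset _ _
theorem high_subset (P : Finset ℕ) : high lam P ⊆ P := filter_subset _ _

theorem low_union_high (P : Finset ℕ) : low lam P ∪ high lam P = P :=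
  filter_union_filter_not_eq _ _

theorem disjoint_low_high (P : Finset ℕ) : Disjoint (low lam P) (high lam P) :=
  disjoint_filter_filter_not _ _ _

variable {lam}

/-- `LOW` is an initial segment of `P` (needs `λ ≥ 0`). -/
theorem mem_low_of_le (hlam : 0 ≤ lam) {P : Finset ℕ} {p q : ℕ} (hp : p ∈ low lam P) (hq : q ∈ P) (hqp : q ≤ p) :
    q ∈ low lam P := by
  unfold low at hp ⊢
  rw [mem_filter] at hp ⊢
  refine ⟨hq, lt_of_le_of_lt ?_ hp.2⟩
  exact mul_le_mul_of_nonneg_left (by exact_mod_cast holes_mono P hqp) hlam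

/-- on `LOW`, the holes of `LOW` are the holes of `P`. -/
theorem holes_low (hlam : 0 ≤ lam) {P : Finset ℕ} {p : ℕ} (hp : p ∈ low lam P) : holes (low lam P) p = holes P p := by
  unfold holes
  congr 1
  ext q
  simp only [mem_filter, mem_range]
  constructor
  · rintro ⟨hq, hnot⟩
    exact ⟨hq, fun hqP => hnot (mem_low_of_le hlam hp hqP hq.le)⟩
  · rintro ⟨hq, hnot⟩
    exact ⟨hq, fun h => hnot (low_subset lam P h)⟩

theorem sum_holes_low (hlam : 0 ≤ lam) (P : Finset ℕ) :
    ∑ p ∈ low lam P, (holes (low lam P) p : ℝ) = ∑ p ∈ low lam P, (holes P p : ℝ) :=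
  sum_congr rfl fun p hp => by rw [holes_low hlam hp]

/-- every `HIGH` element pays for itself: `λ·Σ_HIGH holes ≥ |HIGH|`. -/
theorem card_high_le (P : Finset ℕ) :
    ((high lam P).card : ℝ) ≤ lam * ∑ p ∈ high lam P, (holes P p : ℝ) := by
  rw [mul_sum]
  have : ((high lam P).card : ℝ) = ∑ p ∈ high lam P, (1 : ℝ) := by simp
  rw [this]
  exact sum_le_sum fun p hp => by
    unfold high at hp; rw [mem_filter] at hp; exact not_lt.mp hp.2

/-! ## §2  Runs of a finite set of naturals -/

/-- the maximal intervals `[i,j] ⊆ P` (`i−1, j+1 ∉ P`), as pairs `(i,j)`. -/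
def runs (P : Finset ℕ) : Finset (ℕ × ℕ) :=
  (P ×ˢ P).filter (fun ij => ij.1 ≤ ij.2 ∧ Icc ij.1 ij.2 ⊆ P ∧ (ij.1 = 0 ∨ ij.1 - 1 ∉ P) ∧ ij.2 + 1 ∉ P)

theorem mem_runs {P : Finset ℕ} {ij : ℕ × ℕ} :
    ij ∈ runs P ↔ ij.1 ∈ P ∧ ij.2 ∈ P ∧ ij.1 ≤ ij.2 ∧ Icc ij.1 ij.2 ⊆ P ∧ (ij.1 = 0 ∨ ij.1 - 1 ∉ P) ∧ ij.2 + 1 ∉ P := by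
  unfold runs
  rw [mem_filter, mem_product, and_assoc]

theorem runs_subset (P : Finset ℕ) : runs P ⊆ P ×ˢ P := filter_subset _ _

/-- two runs through a common point coincide. -/
theorem run_unique {P : Finset ℕ} {ij ij' : ℕ × ℕ} (h : ij ∈ runs P) (h' : ij' ∈ runs P) {p : ℕ}
    (hp : ij.1 ≤ p ∧ p ≤ ij.2) (hp' : ij'.1 ≤ p ∧ p ≤ ij'.2) : ij = ij' := by
  rw [mem_runs] at h h'
  obtain ⟨_, _, hle, hI, hs, he⟩ := h
  obtain ⟨_, _, hle', hI', hs', he'⟩ := h'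
  have h1 : ij.1 = ij'.1 := by
    by_contra hne
    rcases lt_or_gt_of_ne hne with hlt | hlt
    · -- ij'.1 - 1 ∈ Icc ij.1 ij.2 ⊆ P
      rcases hs' with h0 | hn
      · omega
      · exact hn (hI (by rw [mem_Icc]; omega))
    · rcases hs with h0 | hn
      · omega
      · exact hn (hI' (by rw [mem_Icc]; omega))
  have h2 : ij.2 = ij'.2 := by
    by_contra hne
    rcases lt_or_gt_of_ne hne with hlt | hlt
    · exact he (hI' (by rw [mem_Icc]; omega))
    · exact he' (hI (by rw [mem_Icc]; omega))
  exact Prod.ext h1 h2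

theorem exists_runStart (P : Finset ℕ) {p : ℕ} (hp : p ∈ P) : ∃ i, Icc i p ⊆ P :=
  ⟨p, fun q hq => by rw [mem_Icc] at hq; rwa [le_antisymm hq.2 hq.1]⟩

theorem exists_runEnd (P : Finset ℕ) (p : ℕ) : ∃ m, p + m + 1 ∉ P :=
  ⟨P.sup id, fun h => by
    have := Finset.le_sup (f := id) h
    simp only [id] at this
    omega⟩

/-- **every element lies in a run.** -/
theorem exists_run {P : Finset ℕ} {p : ℕ} (hp : p ∈ P) : ∃ ij ∈ runs P, ij.1 ≤ p ∧ p ≤ ij.2 := by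
  classical
  let i := Nat.find (exists_runStart P hp)
  let m := Nat.find (exists_runEnd P p)
  have hi : Icc i p ⊆ P := Nat.find_spec (exists_runStart P hp)
  have him : i ≤ p := Nat.find_min' _ (show Icc p p ⊆ P from fun q hq => by
    rw [mem_Icc] at hq; rwa [le_antisymm hq.2 hq.1])
  have hm : p + m + 1 ∉ P := Nat.find_spec (exists_runEnd P p)
  have hbelow : ∀ m' < m, p + m' + 1 ∈ P := fun m' hm' => by
    have := Nat.find_min (exists_runEnd P p) hm'
    exact not_not.mp this
  refine ⟨(i, p + m), ?_, him, Nat.le_add_right p m⟩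
  rw [mem_runs]
  refine ⟨hi (by rw [mem_Icc]; exact ⟨le_rfl, him⟩), ?_, by omega, ?_, ?_, hm⟩
  · rcases Nat.eq_zero_or_pos m with h0 | h0
    · rw [h0, add_zero]; exact hp
    · have := hbelow (m - 1) (by omega)
      rwa [show p + (m - 1) + 1 = p + m by omega] at this
  · intro q hq
    rw [mem_Icc] at hq
    rcases le_or_gt q p with hqp | hqp
    · exact hi (by rw [mem_Icc]; exact ⟨hq.1, hqp⟩)
    · have := hbelow (q - p - 1) (by omega)
      rwa [show p + (q - p - 1) + 1 = q by omega] at this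
  · rcases Nat.eq_zero_or_pos i with h0 | h0
    · exact Or.inl h0
    · right
      intro hmem
      have : Icc (i - 1) p ⊆ P := by
        intro q hq
        rw [mem_Icc] at hq
        rcases eq_or_lt_of_le hq.1 with h | h
        · rwa [← h]
        · exact hi (by rw [mem_Icc]; omega)
      have := Nat.find_min (exists_runStart P hp) (show i - 1 < i by omega)
      exact this ‹_›

/-- the runs through `p` form a singleton. -/
theorem card_runs_filter_mem {P : Finset ℕ} {p : ℕ} (hp : p ∈ P) :
    ((runs P).filter (fun ij => ij.1 ≤ p ∧ p ≤ ij.2)).card = 1 := by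
  obtain ⟨ij, hij, hpij⟩ := exists_run hp
  rw [card_eq_one]
  refine ⟨ij, eq_singleton_iff_unique_mem.mpr ⟨mem_filter.mpr ⟨hij, hpij⟩, fun ij' h' => ?_⟩⟩
  rw [mem_filter] at h'
  exact run_unique h'.1 hij h'.2 hpij

/-- the runs of `P` through both `p` and `q` (empty or a singleton); «same run» = `Nonempty`. -/
def runsThrough (P : Finset ℕ) (p q : ℕ) : Finset (ℕ × ℕ) :=
  (runs P).filter (fun ij => (ij.1 ≤ p ∧ p ≤ ij.2) ∧ (ij.1 ≤ q ∧ q ≤ ij.2))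

theorem card_runsThrough {P : Finset ℕ} (p q : ℕ) :
    (runsThrough P p q).card = if (runsThrough P p q).Nonempty then 1 else 0 := by
  split_ifs with h
  · obtain ⟨ij, hij⟩ := h
    rw [card_eq_one]
    refine ⟨ij, eq_singleton_iff_unique_mem.mpr ⟨hij, fun ij' h' => ?_⟩⟩
    unfold runsThrough at hij h'
    rw [mem_filter] at hij h'
    exact run_unique h'.1 hij.1 h'.2.1 hij.2.1
  · rw [card_eq_zero]
    exact not_nonempty_iff_eq_empty.mp h

theorem mem_of_runsThrough_nonempty {P : Finset ℕ} {p q : ℕ} (h : (runsThrough P p q).Nonempty) : p ∈ P ∧ q ∈ P := by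
  obtain ⟨ij, hij⟩ := h
  unfold runsThrough at hij
  rw [mem_filter, mem_runs] at hij
  exact ⟨hij.1.2.2.2.1 (by rw [mem_Icc]; exact hij.2.1), hij.1.2.2.2.1 (by rw [mem_Icc]; exact hij.2.2)⟩

/-- **`#runs − 1 ≤` the holes below the last run start** (each other run ends in a distinct hole below it). -/
theorem card_runs_le {P : Finset ℕ} (hne : (runs P).Nonempty) :
    ∃ ij ∈ runs P, (runs P).card ≤ holes P ij.1 + 1 := by
  obtain ⟨ij, hij, hmax⟩ := exists_max_image (runs P) (fun ij => ij.1) hne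
  refine ⟨ij, hij, ?_⟩
  have hijP := (mem_runs.mp hij)
  -- the map `ij' ↦ ij'.2 + 1` sends the other runs injectively into the holes below `ij.1`
  have hmaps : ∀ ij' ∈ (runs P).erase ij, ij'.2 + 1 ∈ (range ij.1).filter (fun q => q ∉ P) := by
    intro ij' h'
    rw [mem_erase] at h'
    have h'P := mem_runs.mp h'.2
    rw [mem_filter, mem_range]
    refine ⟨?_, h'P.2.2.2.2.2⟩
    -- ij'.2 < ij.1 : otherwise ij.1 ∈ [ij'.1, ij'.2] and the runs coincide
    have hle : ij'.1 ≤ ij.1 := hmax ij' h'.2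
    by_contra hge
    rw [not_lt] at hge
    have hne : ij'.2 + 1 ≠ ij.1 := fun h => h'P.2.2.2.2.2 (h ▸ hijP.1)
    have : ij.1 ≤ ij'.2 := by omega
    exact h'.1 (run_unique h'.2 hij ⟨hle, this⟩ ⟨le_rfl, hijP.2.2.1⟩)
  have hinj : Set.InjOn (fun ij' : ℕ × ℕ => ij'.2 + 1) ((runs P).erase ij) := by
    intro a ha b hb hab
    simp only at hab
    have hab' : a.2 = b.2 := by omega
    rw [mem_coe, mem_erase] at ha hb
    have haP := mem_runs.mp ha.2
    have hbP := mem_runs.mp hb.2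
    exact run_unique ha.2 hb.2 ⟨haP.2.2.1, le_rfl⟩ ⟨hab' ▸ hbP.2.2.1, hab'.le⟩
  have hcard := card_le_card_of_injOn _ hmaps hinj
  rw [card_erase_of_mem hij] at hcard
  unfold holes
  have := hne.card_pos
  omega

/-! ## §3  Counting identities and the row identity -/

/-- `(1 − |S|)² = 1 − |S| + |S.offDiag|`. -/
theorem sq_one_sub_card (S : Finset ℕ) :
    (1 - (S.card : ℝ)) ^ 2 = 1 - (S.card : ℝ) + (S.offDiag.card : ℝ) := by
  rw [offDiag_card, Nat.cast_sub (Nat.le_mul_self _), Nat.cast_mul]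
  ring

/-- `|B ∩ [i,j]|` written as a filter (`i ≤ q ≤ j`). -/
def ivCard (S : Finset ℕ) (ij : ℕ × ℕ) : ℕ := (S.filter (fun q => ij.1 ≤ q ∧ q ≤ ij.2)).card

theorem offDiag_filter (S : Finset ℕ) (r : ℕ → Prop) [DecidablePred r] :
    (S.filter r).offDiag = S.offDiag.filter (fun pq => r pq.1 ∧ r pq.2) := by
  ext ⟨a, b⟩
  simp only [mem_offDiag, mem_filter]
  tauto

/-- **the runs partition `P`:** `Σ_{runs} |S ∩ run| = |S|` for `S ⊆ P`. -/
theorem sum_runs_ivCard {P S : Finset ℕ} (hS : S ⊆ P) : ∑ ij ∈ runs P, ivCard S ij = S.card := by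
  unfold ivCard
  simp_rw [card_filter]
  rw [sum_comm]
  rw [card_eq_sum_ones S]
  refine sum_congr rfl fun q hq => ?_
  rw [← card_filter]
  exact card_runs_filter_mem (hS hq)

/-- pairs inside runs: `Σ_{runs} |(S ∩ run).offDiag| = #{(p,q) ∈ S.offDiag : same run}` for `S ⊆ P`. -/
theorem sum_runs_offDiag {P S : Finset ℕ} (hS : S ⊆ P) :
    ∑ ij ∈ runs P, ((S.filter (fun q => ij.1 ≤ q ∧ q ≤ ij.2)).offDiag).card =
      (S.offDiag.filter (fun pq => (runsThrough P pq.1 pq.2).Nonempty)).card := by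
  simp_rw [offDiag_filter, card_filter]
  rw [sum_comm]
  refine sum_congr rfl fun pq hpq => ?_
  rw [← card_filter]
  exact card_runsThrough pq.1 pq.2

/-- an interval inside `T` sees only `T ∩ S`. -/
theorem filter_iv_eq_of_subset {T S : Finset ℕ} {ij : ℕ × ℕ} (hI : Icc ij.1 ij.2 ⊆ T) :
    S.filter (fun q => ij.1 ≤ q ∧ q ≤ ij.2) = (T ∩ S).filter (fun q => ij.1 ≤ q ∧ q ≤ ij.2) := by
  ext q
  simp only [mem_filter, mem_inter]
  constructor
  · rintro ⟨hq, h⟩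
    exact ⟨⟨hI (by rw [mem_Icc]; exact h), hq⟩, h⟩
  · rintro ⟨⟨_, hq⟩, h⟩
    exact ⟨hq, h⟩

/-- the hole pedestal `r(P) = Σ_{p∈P} holes_P(p)`. -/
def r (P : Finset ℕ) : ℝ := ∑ p ∈ P, (holes P p : ℝ)

theorem r_nonneg (P : Finset ℕ) : 0 ≤ r P := sum_nonneg fun _ _ => Nat.cast_nonneg _

variable (lam)

/-- `M̄` on position sets: `(1 − |P∩S|)² + λ·r(P)` (for a row `A` this is `M̄(A,B)` by `pedestal_eq`; for a LOW-pattern it is the private column `Y`). -/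
def barVal (P S : Finset ℕ) : ℝ := (1 - ((P ∩ S).card : ℝ)) ^ 2 + lam * r P

theorem barVal_nonneg (hlam : 0 ≤ lam) (P S : Finset ℕ) : 0 ≤ barVal lam P S :=
  add_nonneg (sq_nonneg _) (mul_nonneg hlam (r_nonneg P))

/-- the regular constant `c_A = λ·r(A) + 1 − #runs(LOW) − |HIGH|`. -/
def cReg (P : Finset ℕ) : ℝ := lam * r P + 1 - ((runs (low lam P)).card : ℝ) - ((high lam P).card : ℝ)

/-- the irregular constant `λ·Σ_HIGH holes − |HIGH| ≥ 0`. -/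
def cIrr (P : Finset ℕ) : ℝ := lam * (∑ p ∈ high lam P, (holes P p : ℝ)) - ((high lam P).card : ℝ)

theorem cIrr_nonneg (P : Finset ℕ) : 0 ≤ cIrr lam P := by
  unfold cIrr; have := card_high_le (lam := lam) P; linarith

theorem low_inter_eq (P S : Finset ℕ) : low lam P ∩ S = (P ∩ S).filter (fun p => lam * (holes P p : ℝ) < 1) := by
  ext q; simp only [low, mem_inter, mem_filter]; tauto

theorem high_inter_eq (P S : Finset ℕ) : high lam P ∩ S = (P ∩ S).filter (fun p => ¬ lam * (holes P p : ℝ) < 1) := by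
  ext q; simp only [high, mem_inter, mem_filter]; tauto

theorem card_inter_split (P S : Finset ℕ) :
    (P ∩ S).card = (low lam P ∩ S).card + (high lam P ∩ S).card := by
  rw [low_inter_eq, high_inter_eq, card_filter_add_card_filter_not]

theorem r_split (P : Finset ℕ) :
    r P = (∑ p ∈ low lam P, (holes P p : ℝ)) + ∑ p ∈ high lam P, (holes P p : ℝ) := by
  unfold r low high
  rw [sum_filter_add_sum_filter_not]

theorem card_high_split (P S : Finset ℕ) :
    ((high lam P).filter (fun p => p ∉ S)).card + (high lam P ∩ S).card = (high lam P).card := by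
  rw [← filter_mem_eq_inter, add_comm, card_filter_add_card_filter_not]

theorem offDiag_filter_sameRun (hlam : 0 ≤ lam) (P S : Finset ℕ) :
    (P ∩ S).offDiag.filter (fun pq => (runsThrough (low lam P) pq.1 pq.2).Nonempty) =
      (low lam P ∩ S).offDiag.filter (fun pq => (runsThrough (low lam P) pq.1 pq.2).Nonempty) := by
  ext ⟨p, q⟩
  simp only [mem_filter, mem_offDiag, mem_inter]
  constructor
  · rintro ⟨⟨⟨_, hpS⟩, ⟨_, hqS⟩, hne⟩, hs⟩
    have := mem_of_runsThrough_nonempty hs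
    exact ⟨⟨⟨this.1, hpS⟩, ⟨this.2, hqS⟩, hne⟩, hs⟩
  · rintro ⟨⟨⟨hp, hpS⟩, ⟨hq, hqS⟩, hne⟩, hs⟩
    exact ⟨⟨⟨low_subset lam P hp, hpS⟩, ⟨low_subset lam P hq, hqS⟩, hne⟩, hs⟩

theorem offDiag_filter_bothLow (P S : Finset ℕ) :
    (P ∩ S).offDiag.filter (fun pq => pq.1 ∈ low lam P ∧ pq.2 ∈ low lam P) = (low lam P ∩ S).offDiag := by
  ext ⟨p, q⟩
  simp only [mem_filter, mem_offDiag, mem_inter]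
  constructor
  · rintro ⟨⟨⟨_, hpS⟩, ⟨_, hqS⟩, hne⟩, hp, hq⟩
    exact ⟨⟨hp, hpS⟩, ⟨hq, hqS⟩, hne⟩
  · rintro ⟨⟨hp, hpS⟩, ⟨hq, hqS⟩, hne⟩
    exact ⟨⟨⟨low_subset lam P hp, hpS⟩, ⟨low_subset lam P hq, hqS⟩, hne⟩, hp, hq⟩

/-- the run sum of squares, evaluated: `Σ_{runs(LOW)} (1 − |S∩run|)² = G − |LOW∩S| + #{same-run pairs of (LOW∩S)}`. -/
theorem sum_runs_sq (hlam : 0 ≤ lam) (P S : Finset ℕ) :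
    ∑ ij ∈ runs (low lam P), (1 - (ivCard S ij : ℝ)) ^ 2 =
      ((runs (low lam P)).card : ℝ) - ((low lam P ∩ S).card : ℝ) +
        (((low lam P ∩ S).offDiag.filter (fun pq => (runsThrough (low lam P) pq.1 pq.2).Nonempty)).card : ℝ) := by
  have hterm : ∀ ij ∈ runs (low lam P), (1 - (ivCard S ij : ℝ)) ^ 2 =
      1 - (ivCard (low lam P ∩ S) ij : ℝ) +
        ((((low lam P ∩ S).filter (fun q => ij.1 ≤ q ∧ q ≤ ij.2)).offDiag).card : ℝ) := by
    intro ij hij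
    have hI : Icc ij.1 ij.2 ⊆ low lam P := (mem_runs.mp hij).2.2.2.1
    unfold ivCard
    rw [filter_iv_eq_of_subset (S := S) hI, sq_one_sub_card]
  rw [sum_congr rfl hterm, sum_add_distrib, sum_sub_distrib, sum_const, nsmul_eq_mul, mul_one]
  have h1 := sum_runs_ivCard (P := low lam P) (S := low lam P ∩ S) inter_subset_left
  have h2 := sum_runs_offDiag (P := low lam P) (S := low lam P ∩ S) inter_subset_left
  rw [← Nat.cast_sum, ← Nat.cast_sum, h1, h2]

/-- **ROW IDENTITY (regular form), valid for every row.** -/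
theorem rowIdentity_regular (hlam : 0 ≤ lam) (P S : Finset ℕ) :
    barVal lam P S = cReg lam P + (∑ ij ∈ runs (low lam P), (1 - (ivCard S ij : ℝ)) ^ 2)
      + (((P ∩ S).offDiag.filter (fun pq => ¬ (runsThrough (low lam P) pq.1 pq.2).Nonempty)).card : ℝ)
      + (((high lam P).filter (fun p => p ∉ S)).card : ℝ) := by
  have ht := card_inter_split lam P S
  have hsq := sq_one_sub_card (P ∩ S)
  have hpairs := card_filter_add_card_filter_not (s := (P ∩ S).offDiag) (fun pq => (runsThrough (low lam P) pq.1 pq.2).Nonempty)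
  rw [offDiag_filter_sameRun lam hlam] at hpairs
  have hH := card_high_split lam P S
  have hruns := sum_runs_sq lam hlam P S
  unfold barVal cReg
  rw [hruns, hsq]
  have ht' : ((P ∩ S).card : ℝ) = ((low lam P ∩ S).card : ℝ) + ((high lam P ∩ S).card : ℝ) := by exact_mod_cast ht
  have hpairs' : (((low lam P ∩ S).offDiag.filter (fun pq => (runsThrough (low lam P) pq.1 pq.2).Nonempty)).card : ℝ)
      + (((P ∩ S).offDiag.filter (fun pq => ¬ (runsThrough (low lam P) pq.1 pq.2).Nonempty)).card : ℝ) = ((P ∩ S).offDiag.card : ℝ) := by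
    exact_mod_cast hpairs
  have hH' : (((high lam P).filter (fun p => p ∉ S)).card : ℝ) + ((high lam P ∩ S).card : ℝ) = ((high lam P).card : ℝ) := by
    exact_mod_cast hH
  linarith

/-- **ROW IDENTITY (irregular form), valid for every row.** -/
theorem rowIdentity_irregular (hlam : 0 ≤ lam) (P S : Finset ℕ) :
    barVal lam P S = cIrr lam P + barVal lam (low lam P) S
      + (((P ∩ S).offDiag.filter (fun pq => ¬ (pq.1 ∈ low lam P ∧ pq.2 ∈ low lam P))).card : ℝ)
      + (((high lam P).filter (fun p => p ∉ S)).card : ℝ) := by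
  have ht := card_inter_split lam P S
  have hsq := sq_one_sub_card (P ∩ S)
  have hsqL := sq_one_sub_card (low lam P ∩ S)
  have hpairs := card_filter_add_card_filter_not (s := (P ∩ S).offDiag) (fun pq => pq.1 ∈ low lam P ∧ pq.2 ∈ low lam P)
  rw [offDiag_filter_bothLow] at hpairs
  have hH := card_high_split lam P S
  have hr := r_split lam P
  have hrL : r (low lam P) = ∑ p ∈ low lam P, (holes P p : ℝ) := sum_holes_low hlam P
  unfold barVal cIrr
  rw [hsq, hsqL, hrL]
  have ht' : ((P ∩ S).card : ℝ) = ((low lam P ∩ S).card : ℝ) + ((high lam P ∩ S).card : ℝ) := by exact_mod_cast ht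
  have hpairs' : (((low lam P ∩ S).offDiag).card : ℝ)
      + (((P ∩ S).offDiag.filter (fun pq => ¬ (pq.1 ∈ low lam P ∧ pq.2 ∈ low lam P))).card : ℝ) = ((P ∩ S).offDiag.card : ℝ) := by
    exact_mod_cast hpairs
  have hH' : (((high lam P).filter (fun p => p ∉ S)).card : ℝ) + ((high lam P ∩ S).card : ℝ) = ((high lam P).card : ℝ) := by
    exact_mod_cast hH
  rw [hr]
  linarith

/-! ## §4  Irregular LOW-patterns are few: `[0,m) ⊔ (m+1+Q)`, `m ≤ k`, `Q ⊆ [0, h(h+2))` -/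

/-- the least natural number not in `P`. -/
def leastOut (P : Finset ℕ) : ℕ := Nat.find (Infinite.exists_notMem_finset P)

theorem leastOut_not_mem (P : Finset ℕ) : leastOut P ∉ P := Nat.find_spec (Infinite.exists_notMem_finset P)

theorem mem_of_lt_leastOut {P : Finset ℕ} {q : ℕ} (hq : q < leastOut P) : q ∈ P := by
  have := Nat.find_min (Infinite.exists_notMem_finset P) hq
  exact not_not.mp this

theorem leastOut_eq {P : Finset ℕ} {m : ℕ} (hm : m ∉ P) (hbelow : ∀ q < m, q ∈ P) : leastOut P = m := by
  apply le_antisymm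
  · exact Nat.find_min' _ hm
  · by_contra hlt
    exact leastOut_not_mem P (hbelow _ (not_le.mp hlt))

theorem range_leastOut_subset (P : Finset ℕ) : range (leastOut P) ⊆ P :=
  fun q hq => mem_of_lt_leastOut (mem_range.mp hq)

theorem leastOut_le_card (P : Finset ℕ) : leastOut P ≤ P.card := by
  have := card_le_card (range_leastOut_subset P)
  rwa [card_range] at this

/-- `decode (m, Q) = [0,m) ∪ (m+1+Q)`. -/
def decode (m : ℕ) (Q : Finset ℕ) : Finset ℕ := range m ∪ Q.map (addLeftEmbedding (m + 1))

theorem mem_decode {m : ℕ} {Q : Finset ℕ} {q : ℕ} : q ∈ decode m Q ↔ q < m ∨ ∃ i ∈ Q, m + 1 + i = q := by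
  unfold decode
  rw [mem_union, mem_range, mem_map]
  simp only [addLeftEmbedding_apply]

theorem leastOut_decode (m : ℕ) (Q : Finset ℕ) : leastOut (decode m Q) = m := by
  apply leastOut_eq
  · rw [mem_decode]
    rintro (h | ⟨i, _, hi⟩)
    · exact lt_irrefl _ h
    · omega
  · intro q hq
    exact mem_decode.mpr (Or.inl hq)

theorem decode_filter_gt (m : ℕ) (Q : Finset ℕ) :
    (decode m Q).filter (fun q => m < q) = Q.map (addLeftEmbedding (m + 1)) := by
  ext q
  rw [mem_filter, mem_decode, mem_map]
  simp only [addLeftEmbedding_apply]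
  constructor
  · rintro ⟨h | h, hmq⟩
    · omega
    · exact h
  · rintro ⟨i, hi, rfl⟩
    exact ⟨Or.inr ⟨i, hi, rfl⟩, by omega⟩

theorem decode_injective {m m' : ℕ} {Q Q' : Finset ℕ} (h : decode m Q = decode m' Q') : m = m' ∧ Q = Q' := by
  have hm : m = m' := by rw [← leastOut_decode m Q, h, leastOut_decode]
  subst hm
  refine ⟨rfl, ?_⟩
  have h1 := decode_filter_gt m Q
  rw [h, decode_filter_gt] at h1
  exact (map_injective _ h1).symm

variable {lam}

/-- LOW elements have at most `h` holes below them (`λ·holes < 1 ≤ λ(h+1)`). -/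
theorem holes_le_of_mem_low (hlam : 0 < lam) {h : ℕ} (hh : 1 ≤ lam * (h + 1)) {P : Finset ℕ} {p : ℕ}
    (hp : p ∈ low lam P) : holes P p ≤ h := by
  unfold low at hp
  rw [mem_filter] at hp
  have : (holes P p : ℝ) < h + 1 := by
    by_contra hge
    rw [not_lt] at hge
    have := mul_le_mul_of_nonneg_left hge hlam.le
    linarith [hp.2]
  exact_mod_cast Nat.lt_succ_iff.mp (by exact_mod_cast this : holes P p < h + 1)

/-- **Irregular rows have a short LOW-pattern:** if `c_A < 0` then `LOW(A) = [0,m) ⊔ (m+1+Q)` with `m` the least hole and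
`Q ⊆ [0, h(h+2))`. -/
theorem irregular_pattern (hlam : 0 < lam) {h : ℕ} (hh : 1 ≤ lam * (h + 1)) {P : Finset ℕ}
    (hirr : cReg lam P < 0) :
    ∃ Q ⊆ range (h * (h + 2)), decode (leastOut (low lam P)) Q = low lam P := by
  set L₀ := low lam P with hL₀
  set m := leastOut L₀ with hm
  set T := L₀.filter (fun q => m < q) with hT
  -- Step 1: λ·r(LOW) < G − 1
  have hG : lam * r L₀ < ((runs L₀).card : ℝ) - 1 := by
    unfold cReg at hirr
    rw [r_split lam P] at hirr
    have h1 := card_high_le (lam := lam) P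
    have h2 : r L₀ = ∑ p ∈ low lam P, (holes P p : ℝ) := sum_holes_low hlam.le P
    rw [h2]
    linarith
  -- Step 2: G − 1 ≤ h
  have hne : (runs L₀).Nonempty := by
    rw [← card_pos]
    by_contra h0
    rw [not_lt, Nat.le_zero] at h0
    rw [h0] at hG
    have := mul_nonneg hlam.le (r_nonneg L₀)
    simp at hG
    linarith
  obtain ⟨ij, hij, hcard⟩ := card_runs_le hne
  have hij1 : ij.1 ∈ L₀ := (mem_runs.mp hij).1
  have hholes : holes L₀ ij.1 ≤ h := by
    rw [holes_low hlam.le hij1]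
    exact holes_le_of_mem_low hlam hh hij1
  have hGh : ((runs L₀).card : ℝ) - 1 ≤ h := by
    have : (runs L₀).card ≤ h + 1 := hcard.trans (by omega)
    have : ((runs L₀).card : ℝ) ≤ (h : ℝ) + 1 := by exact_mod_cast this
    linarith
  -- Step 3: r(LOW) < h(h+1), as naturals
  have hrlt : lam * r L₀ < h := lt_of_lt_of_le hG hGh
  have hr0 := r_nonneg L₀
  have hrR : r L₀ < (h : ℝ) * (h + 1) := by
    have h1 : r L₀ ≤ r L₀ * (lam * (h + 1)) := le_mul_of_one_le_right hr0 hh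
    have h2 : r L₀ * (lam * (h + 1)) = (lam * r L₀) * (h + 1) := by ring
    have h3 : (lam * r L₀) * ((h : ℝ) + 1) < h * ((h : ℝ) + 1) :=
      mul_lt_mul_of_pos_right hrlt (by positivity)
    linarith
  have hrN : ∑ p ∈ L₀, holes L₀ p < h * (h + 1) := by
    have : ((∑ p ∈ L₀, holes L₀ p : ℕ) : ℝ) < ((h * (h + 1) : ℕ) : ℝ) := by
      push_cast
      unfold r at hrR
      exact hrR
    exact_mod_cast this
  -- Step 4: |T| ≤ Σ holes
  have hmL : m ∉ L₀ := leastOut_not_mem L₀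
  have hTsub : T ⊆ L₀ := filter_subset _ _
  have hτ : T.card ≤ ∑ p ∈ L₀, holes L₀ p := by
    calc T.card = ∑ p ∈ T, 1 := by rw [card_eq_sum_ones]
      _ ≤ ∑ p ∈ T, holes L₀ p := sum_le_sum fun p hp => by
          rw [hT, mem_filter] at hp
          exact one_le_holes hmL hp.2
      _ ≤ ∑ p ∈ L₀, holes L₀ p := sum_le_sum_of_subset hTsub
  -- Step 5: every tail element is small
  have hsmall : ∀ p ∈ T, p + 1 ≤ m + T.card + h := by
    intro p hp
    have hpL : p ∈ L₀ := hTsub hp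
    have hmp : m < p := by rw [hT, mem_filter] at hp; exact hp.2
    have hb : below L₀ p ≤ m + (T.card - 1) := by
      unfold below
      have hsub : (range p).filter (fun q => q ∈ L₀) ⊆ range m ∪ T.erase p := by
        intro q hq
        rw [mem_filter, mem_range] at hq
        rw [mem_union, mem_range, mem_erase, hT, mem_filter]
        rcases lt_trichotomy q m with h1 | h1 | h1
        · exact Or.inl h1
        · exact absurd hq.2 (h1 ▸ hmL)
        · exact Or.inr ⟨by omega, hq.2, h1⟩
      calc ((range p).filter (fun q => q ∈ L₀)).card ≤ (range m ∪ T.erase p).card := card_le_card hsub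
        _ ≤ (range m).card + (T.erase p).card := card_union_le _ _
        _ = m + (T.card - 1) := by rw [card_range, card_erase_of_mem hp]
    have hh' : holes L₀ p ≤ h := holes_le_of_mem_low hlam hh (by
      show p ∈ low lam L₀
      unfold low; rw [mem_filter]; refine ⟨hpL, ?_⟩
      rw [holes_low hlam.le hpL]
      rw [hL₀] at hpL; unfold low at hpL; exact (mem_filter.mp hpL).2)
    have := below_add_holes L₀ p
    have hTpos : 0 < T.card := card_pos.mpr ⟨p, hp⟩
    omega
  -- Step 6: encode
  refine ⟨T.image (fun p => p - (m + 1)), ?_, ?_⟩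
  · intro i hi
    rw [mem_image] at hi
    obtain ⟨p, hp, rfl⟩ := hi
    rw [mem_range]
    have h1 := hsmall p hp
    have h2 : h * (h + 2) = h * (h + 1) + h := by ring
    rw [h2]
    omega
  · ext q
    rw [mem_decode]
    constructor
    · rintro (hq | ⟨i, hi, rfl⟩)
      · exact mem_of_lt_leastOut hq
      · rw [mem_image] at hi
        obtain ⟨p, hp, rfl⟩ := hi
        have hmp : m < p := by rw [hT, mem_filter] at hp; exact hp.2
        rw [show m + 1 + (p - (m + 1)) = p by omega]
        exact hTsub hp
    · intro hq
      rcases lt_trichotomy q m with h1 | h1 | h1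
      · exact Or.inl h1
      · exact absurd hq (h1 ▸ hmL)
      · right
        refine ⟨q - (m + 1), mem_image.mpr ⟨q, ?_, rfl⟩, by omega⟩
        rw [hT, mem_filter]; exact ⟨hq, h1⟩

/-! ## §5  The factorisation through `1 + n² + n² + n + (k+1)·2^{h(h+2)}` slots -/

/-- interval / pair slots `(i,j) ∈ [n]²`. -/
def box2 (n : ℕ) : Finset (ℕ × ℕ) := range n ×ˢ range n

/-- private slots `(m, Q)`, `m ≤ k`, `Q ⊆ [0,L)`. -/
def box5 (k L : ℕ) : Finset (ℕ × Finset ℕ) := range (k + 1) ×ˢ (range L).powerset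

/-- the slot type: constant ⊕ intervals ⊕ ordered pairs ⊕ misses ⊕ private patterns. -/
abbrev Slot (n k L : ℕ) := Unit ⊕ (box2 n) ⊕ (box2 n) ⊕ (range n) ⊕ (box5 k L)

theorem card_slot (n k L : ℕ) : Fintype.card (Slot n k L) = 2 * n ^ 2 + n + 1 + (k + 1) * 2 ^ L := by
  rw [Fintype.card_sum, Fintype.card_sum, Fintype.card_sum, Fintype.card_sum, Fintype.card_unit,
    Fintype.card_coe, Fintype.card_coe, Fintype.card_coe, box2, box5, card_product, card_product, card_range,
    card_range, card_powerset, card_range]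
  ring

variable (lam)

/-- ROW FACTORS of the certificate (all `≥ 0`). -/
def rowF {n k L : ℕ} (P : Finset ℕ) : Slot n k L → ℝ
  | Sum.inl _ => if 0 ≤ cReg lam P then cReg lam P else cIrr lam P
  | Sum.inr (Sum.inl ij) => if 0 ≤ cReg lam P ∧ ij.1 ∈ runs (low lam P) then 1 else 0
  | Sum.inr (Sum.inr (Sum.inl pq)) =>
      if pq.1 ∈ P.offDiag ∧ ((0 ≤ cReg lam P → ¬ (runsThrough (low lam P) pq.1.1 pq.1.2).Nonempty) ∧ (¬ 0 ≤ cReg lam P → ¬ (pq.1.1 ∈ low lam P ∧ pq.1.2 ∈ low lam P))) then 1 else 0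
  | Sum.inr (Sum.inr (Sum.inr (Sum.inl p))) => if p.1 ∈ high lam P then 1 else 0
  | Sum.inr (Sum.inr (Sum.inr (Sum.inr mQ))) => if ¬ 0 ≤ cReg lam P ∧ decode mQ.1.1 mQ.1.2 = low lam P then 1 else 0

/-- COLUMN FACTORS of the certificate (all `≥ 0`; universal except the private `barVal (decode m Q)`). -/
def colF {n k L : ℕ} (S : Finset ℕ) : Slot n k L → ℝ
  | Sum.inl _ => 1
  | Sum.inr (Sum.inl ij) => (1 - (ivCard S ij.1 : ℝ)) ^ 2
  | Sum.inr (Sum.inr (Sum.inl pq)) => if pq.1.1 ∈ S ∧ pq.1.2 ∈ S then 1 else 0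
  | Sum.inr (Sum.inr (Sum.inr (Sum.inl p))) => if p.1 ∉ S then 1 else 0
  | Sum.inr (Sum.inr (Sum.inr (Sum.inr mQ))) => barVal lam (decode mQ.1.1 mQ.1.2) S

theorem rowF_nonneg {n k L : ℕ} (P : Finset ℕ) (s : Slot n k L) : 0 ≤ rowF lam P s := by
  rcases s with _ | ij | pq | p | mQ <;> simp only [rowF]
  · split_ifs with h
    · exact h
    · exact cIrr_nonneg lam P
  all_goals split_ifs <;> norm_num

theorem colF_nonneg (hlam : 0 ≤ lam) {n k L : ℕ} (S : Finset ℕ) (s : Slot n k L) : 0 ≤ colF lam S s := by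
  rcases s with _ | ij | pq | p | mQ <;> simp only [colF]
  · norm_num
  · exact sq_nonneg _
  · split_ifs <;> norm_num
  · split_ifs <;> norm_num
  · exact barVal_nonneg lam hlam _ _

variable {lam}

/-- block 2 (intervals). -/
theorem sum_block2 {n : ℕ} {P : Finset ℕ} (hP : P ⊆ range n) (S : Finset ℕ) :
    ∑ x ∈ box2 n, (if 0 ≤ cReg lam P ∧ x ∈ runs (low lam P) then (1 : ℝ) else 0) * (1 - (ivCard S x : ℝ)) ^ 2 =
      if 0 ≤ cReg lam P then ∑ ij ∈ runs (low lam P), (1 - (ivCard S ij : ℝ)) ^ 2 else 0 := by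
  have hsub : runs (low lam P) ⊆ box2 n := fun ij hij =>
    mem_product.mpr ⟨hP (low_subset lam P (mem_runs.mp hij).1), hP (low_subset lam P (mem_runs.mp hij).2.1)⟩
  split_ifs with hreg
  · have : ∀ x ∈ box2 n, (if 0 ≤ cReg lam P ∧ x ∈ runs (low lam P) then (1 : ℝ) else 0) * (1 - (ivCard S x : ℝ)) ^ 2 =
        if x ∈ runs (low lam P) then (1 - (ivCard S x : ℝ)) ^ 2 else 0 := fun x _ => by
      split_ifs with h1 h2 h2 <;> simp_all
    rw [sum_congr rfl this, sum_ite_mem, inter_eq_right.mpr hsub]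
  · exact sum_eq_zero fun x _ => by simp [hreg]

/-- block 3 (ordered pairs), for any pair condition `C`. -/
theorem sum_block3 {n : ℕ} {P : Finset ℕ} (hP : P ⊆ range n) (S : Finset ℕ) (C : ℕ × ℕ → Prop) [DecidablePred C] :
    ∑ x ∈ box2 n, (if x ∈ P.offDiag ∧ C x then (1 : ℝ) else 0) * (if x.1 ∈ S ∧ x.2 ∈ S then (1 : ℝ) else 0) =
      (((P ∩ S).offDiag.filter (fun pq => C pq)).card : ℝ) := by
  have : ∀ x ∈ box2 n, (if x ∈ P.offDiag ∧ C x then (1 : ℝ) else 0) * (if x.1 ∈ S ∧ x.2 ∈ S then (1 : ℝ) else 0) =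
      if x ∈ (P ∩ S).offDiag.filter (fun pq => C pq) then 1 else 0 := fun x _ => by
    have hiff : x ∈ (P ∩ S).offDiag.filter (fun pq => C pq) ↔
        (x ∈ P.offDiag ∧ C x) ∧ (x.1 ∈ S ∧ x.2 ∈ S) := by
      rw [mem_filter, mem_offDiag, mem_offDiag, mem_inter, mem_inter]; tauto
    rw [ite_zero_mul_ite_zero, one_mul]
    exact (if_congr hiff rfl rfl).symm
  rw [sum_congr rfl this, sum_ite_mem, inter_eq_right.mpr, sum_const, nsmul_eq_mul, mul_one]
  intro x hx
  rw [mem_filter, mem_offDiag, mem_inter, mem_inter] at hx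
  exact mem_product.mpr ⟨hP hx.1.1.1, hP hx.1.2.1.1⟩

/-- block 4 (misses of HIGH). -/
theorem sum_block4 {n : ℕ} {P : Finset ℕ} (hP : P ⊆ range n) (S : Finset ℕ) :
    ∑ p ∈ range n, (if p ∈ high lam P then (1 : ℝ) else 0) * (if p ∉ S then (1 : ℝ) else 0) =
      (((high lam P).filter (fun p => p ∉ S)).card : ℝ) := by
  have : ∀ p ∈ range n, (if p ∈ high lam P then (1 : ℝ) else 0) * (if p ∉ S then (1 : ℝ) else 0) =
      if p ∈ (high lam P).filter (fun p => p ∉ S) then 1 else 0 := fun p _ => by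
    rw [ite_zero_mul_ite_zero, one_mul]
    exact (if_congr (by rw [mem_filter]) rfl rfl).symm
  rw [sum_congr rfl this, sum_ite_mem, inter_eq_right.mpr, sum_const, nsmul_eq_mul, mul_one]
  exact (filter_subset _ _).trans ((high_subset lam P).trans hP)

/-- block 5 (private patterns): exactly one private slot fires on an irregular row. -/
theorem sum_block5 (hlam : 0 < lam) {h k : ℕ} (hh : 1 ≤ lam * (h + 1)) {P : Finset ℕ} (hPk : P.card = k)
    (S : Finset ℕ) :
    ∑ x ∈ box5 k (h * (h + 2)),
        (if ¬ 0 ≤ cReg lam P ∧ decode x.1 x.2 = low lam P then (1 : ℝ) else 0) * barVal lam (decode x.1 x.2) S =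
      if 0 ≤ cReg lam P then 0 else barVal lam (low lam P) S := by
  split_ifs with hreg
  · exact sum_eq_zero fun x _ => by simp [hreg]
  · have : ∀ x ∈ box5 k (h * (h + 2)),
        (if ¬ 0 ≤ cReg lam P ∧ decode x.1 x.2 = low lam P then (1 : ℝ) else 0) * barVal lam (decode x.1 x.2) S =
        if decode x.1 x.2 = low lam P then barVal lam (low lam P) S else 0 := fun x _ => by
      split_ifs with h1 h2 h2
      · rw [one_mul, h2]
      · exact absurd h1.2 h2
      · exact absurd ⟨hreg, h2⟩ h1
      · rw [zero_mul]
    rw [sum_congr rfl this, ← sum_filter, sum_const, nsmul_eq_mul]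
    -- the filter is a singleton
    obtain ⟨Q, hQ, hdec⟩ := irregular_pattern hlam hh (not_le.mp hreg)
    have hm : leastOut (low lam P) ≤ k :=
      (leastOut_le_card _).trans ((card_le_card (low_subset lam P)).trans hPk.le)
    have hcard : ((box5 k (h * (h + 2))).filter (fun x => decode x.1 x.2 = low lam P)).card = 1 := by
      rw [card_eq_one]
      refine ⟨(leastOut (low lam P), Q), eq_singleton_iff_unique_mem.mpr ⟨?_, fun x hx => ?_⟩⟩
      · rw [mem_filter]
        refine ⟨mem_product.mpr ⟨mem_range.mpr (by omega), mem_powerset.mpr hQ⟩, hdec⟩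
      · rw [mem_filter] at hx
        have := decode_injective (hx.2.trans hdec.symm)
        exact Prod.ext this.1 this.2
    rw [hcard]
    simp

/-- **THE CERTIFICATE, row by row:** for `P ⊆ [n]`, `|P| = k`, every column `S`,
`M̄(P,S) = Σ_{slots} rowF(P)·colF(S)`. -/
theorem barVal_eq_sum (hlam : 0 < lam) {h n k : ℕ} (hh : 1 ≤ lam * (h + 1)) {P : Finset ℕ} (hP : P ⊆ range n)
    (hPk : P.card = k) (S : Finset ℕ) :
    barVal lam P S = ∑ s : Slot n k (h * (h + 2)), rowF lam P s * colF lam S s := by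
  rw [Fintype.sum_sum_type, Fintype.sum_sum_type, Fintype.sum_sum_type, Fintype.sum_sum_type]
  simp only [rowF, colF, Fintype.sum_unique, mul_one]
  rw [sum_coe_sort (box2 n) (fun x => (if 0 ≤ cReg lam P ∧ x ∈ runs (low lam P) then (1 : ℝ) else 0) *
      (1 - (ivCard S x : ℝ)) ^ 2),
    sum_coe_sort (box2 n) (fun x => (if x ∈ P.offDiag ∧ ((0 ≤ cReg lam P → ¬ (runsThrough (low lam P) x.1 x.2).Nonempty) ∧ (¬ 0 ≤ cReg lam P → ¬ (x.1 ∈ low lam P ∧ x.2 ∈ low lam P))) then (1 : ℝ) else 0) *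
      (if x.1 ∈ S ∧ x.2 ∈ S then (1 : ℝ) else 0)),
    sum_coe_sort (range n) (fun p => (if p ∈ high lam P then (1 : ℝ) else 0) * (if p ∉ S then (1 : ℝ) else 0)),
    sum_coe_sort (box5 k (h * (h + 2))) (fun x =>
      (if ¬ 0 ≤ cReg lam P ∧ decode x.1 x.2 = low lam P then (1 : ℝ) else 0) * barVal lam (decode x.1 x.2) S),
    sum_block2 hP, sum_block3 hP S, sum_block4 hP, sum_block5 hlam hh hPk]
  by_cases hreg : 0 ≤ cReg lam P
  · have hpc : (P ∩ S).offDiag.filter (fun PQ => ((0 ≤ cReg lam P → ¬ (runsThrough (low lam P) PQ.1 PQ.2).Nonempty) ∧ (¬ 0 ≤ cReg lam P → ¬ (PQ.1 ∈ low lam P ∧ PQ.2 ∈ low lam P)))) =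
        (P ∩ S).offDiag.filter (fun pq => ¬ (runsThrough (low lam P) pq.1 pq.2).Nonempty) :=
      filter_congr fun x _ => by tauto
    rw [if_pos hreg, if_pos hreg, if_pos hreg, hpc, rowIdentity_regular lam hlam.le P S]
    ring
  · have hpc : (P ∩ S).offDiag.filter (fun PQ => ((0 ≤ cReg lam P → ¬ (runsThrough (low lam P) PQ.1 PQ.2).Nonempty) ∧ (¬ 0 ≤ cReg lam P → ¬ (PQ.1 ∈ low lam P ∧ PQ.2 ∈ low lam P)))) =
        (P ∩ S).offDiag.filter (fun pq => ¬ (pq.1 ∈ low lam P ∧ pq.2 ∈ low lam P)) :=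
      filter_congr fun x _ => by tauto
    rw [if_neg hreg, if_neg hreg, if_neg hreg, hpc, rowIdentity_irregular lam hlam.le P S]
    ring

/-! ## §6  Back to `Fin n`: the theorem -/

/-- positions of a set of `Fin n` as naturals. -/
def nat {n : ℕ} (A : Finset (Fin n)) : Finset ℕ := A.map Fin.valEmbedding

theorem nat_subset_range {n : ℕ} (A : Finset (Fin n)) : nat A ⊆ range n := fun q hq => by
  unfold nat at hq
  rw [mem_map] at hq
  obtain ⟨p, _, rfl⟩ := hq
  exact mem_range.mpr p.isLt

theorem card_nat {n : ℕ} (A : Finset (Fin n)) : (nat A).card = A.card := card_map _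

/-- `M̄(A,B) = barVal (nat A) (nat B)` on the slice `|A| = k` (the pedestal is the hole count). -/
theorem pencilBar_eq_barVal {n k : ℕ} {A : Finset (Fin n)} (hA : A.card = k) (B : Finset (Fin n)) :
    pencilBar n lam k A B = barVal lam (nat A) (nat B) := by
  unfold pencilBar barVal r
  have h1 : ((A ∩ B).card : ℝ) = ((nat A ∩ nat B).card : ℝ) := by
    unfold nat; rw [← map_inter, card_map]
  have h2 : (∑ p ∈ A, ((p : ℕ) : ℝ)) = ∑ q ∈ nat A, (q : ℝ) := by
    unfold nat; rw [sum_map]; rfl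
  rw [h1, h2, ← pedestal_eq (nat A), card_nat, hA]

/-- ★ **ONE BLOCK IS EASY.**  For every `n, k` and every real `λ > 0` with `λ(h+1) ≥ 1` (i.e. `h ≥ ⌈1/λ⌉ − 1`), the `k`-slice
of the reduced located matrix `M̄_{λ,k}(A,B) = (1 − |A∩B|)² + λ(ΣA − k(k−1)/2)` has a nonnegative factorisation of size
`2n² + n + 1 + (k+1)·2^{h(h+2)}` — `n`-exponent 2 for every fixed `λ`, refuting the pointer LL-1(M̄) `rank₊ M̄_{λ,k} ≥ n^{c·min(k,1/λ)}`. -/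
theorem pencilBar_hasNonnegFactorization (n k h : ℕ) (hlam : 0 < lam) (hh : 1 ≤ lam * (h + 1)) :
    Literature.Combinatorics.Optimization.HasNonnegFactorization (pencilBarSlice n lam k)
      (2 * n ^ 2 + n + 1 + (k + 1) * 2 ^ (h * (h + 2))) := by
  rw [← card_slot n k (h * (h + 2))]
  refine Literature.Combinatorics.Optimization.hasNonnegFactorization_of_fintype
    (fun A s => rowF lam (nat A.1) s) (fun s B => colF lam (nat B) s)
    (fun A s => rowF_nonneg lam _ s) (fun s B => colF_nonneg lam hlam.le _ s) ?_
  intro A B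
  show pencilBar n lam k A.1 B = _
  rw [pencilBar_eq_barVal A.2 B]
  exact barVal_eq_sum hlam hh (nat_subset_range A.1) (by rw [card_nat, A.2]) (nat B)

/-- the same with the ceiling spelled out: `h = ⌈1/λ⌉₊ − 1` works (`λ·⌈1/λ⌉₊ ≥ 1`). -/
theorem pencilBar_hasNonnegFactorization_ceil (n k : ℕ) (hlam : 0 < lam) :
    Literature.Combinatorics.Optimization.HasNonnegFactorization (pencilBarSlice n lam k)
      (2 * n ^ 2 + n + 1 + (k + 1) * 2 ^ ((⌈1 / lam⌉₊ - 1) * ((⌈1 / lam⌉₊ - 1) + 2))) := by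
  apply pencilBar_hasNonnegFactorization n k _ hlam
  have h1 : (1 : ℝ) ≤ ⌈1 / lam⌉₊ := by
    have : (0 : ℝ) < 1 / lam := by positivity
    exact_mod_cast Nat.one_le_iff_ne_zero.mpr (Nat.pos_iff_ne_zero.mp (Nat.ceil_pos.mpr this))
  have h2 : (((⌈1 / lam⌉₊ - 1 : ℕ) : ℝ) + 1) = ⌈1 / lam⌉₊ := by
    rw [Nat.cast_sub (by exact_mod_cast h1)]; push_cast; ring
  rw [h2]
  have h3 : 1 / lam ≤ ⌈1 / lam⌉₊ := Nat.le_ceil _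
  calc (1 : ℝ) = lam * (1 / lam) := by field_simp
    _ ≤ lam * ⌈1 / lam⌉₊ := mul_le_mul_of_nonneg_left h3 hlam.le


/-! ## §7  The `n`-free term is NECESSARY: one block sees `UDISJ` — `rank₊ M̄_{λ,k} ≥ 2^{Ω(min(k, n−k, λ^{−1/2}))}` (REV 2)

Inside ONE block take the rows `A_a = [0,f) ∪ {f + 2i + [i ∈ a] : i < m} ∪ {f + 2m + 2i + [i ∉ a] : i < m}` (`a ⊆ [m]`,
`k = f + 2m`, `f + 4m ≤ n`): all have `|A_a| = k` and the SAME pedestal `ΣA_a − k(k−1)/2 = 2m²` (the complemented second copy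
cancels the `|a|` of the first), and against the columns `B_b = {f + 2i + 1 : i ∈ b}` they give `|A_a ∩ B_b| = |a ∩ b|`.  So the
`k`-slice of `M̄_{λ,k}` CONTAINS the `ρ`-extension `(1 − |a∩b|)² + 2λm²` of `UDISJ_m` (`ρ = 1 + 2λm²`), and the tree's discharged
BFPS 2012 Theorem 5 (`Literature.Combinatorics.Optimization.udisjShift_nonnegRank_explicit`) applies verbatim: with `λm² ≤ 1/2`
(`ρ ≤ 2`) every nonnegative factorisation of the slice through `N` slots has `e^{(j+1)/576} ≤ 64(j+1)·N` whenever `4j + 3 ≤ m`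
(`singleBlock_visible`).  Reading: ONE BLOCK costs `Θ(n²)` (★ + the pair-coefficient rank bound) PLUS an `n`-FREE term which is
genuinely exponential in a power of `h ≍ 1/λ` — between `2^{Ω(√h)}` (here; needs `k, n − k ≥ 2√(2h)`-ish) and `(k+1)·2^{h(h+2)}` (★);
which power of `h` is the truth is open.  Nothing here bears on the pencil's gluing question or on 21181.
[cite: BraunEtAl2012, Thm 5 (§3.2, pp. 11–12)] -/

section Visible

variable {n f m : ℕ} (hn : f + 4 * m ≤ n)

/-- `[0, f)` embedded in `Fin n` -/
def eF (i : Fin f) : Fin n := ⟨(i : ℕ), by have := i.2; omega⟩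

/-- first copy: `i ↦ f + 2i + [i ∈ a]` -/
def eG₁ (a : Finset (Fin m)) (i : Fin m) : Fin n :=
  ⟨f + 2 * (i : ℕ) + (if i ∈ a then 1 else 0), by have := i.2; split_ifs <;> omega⟩

/-- complemented copy: `i ↦ f + 2m + 2i + [i ∉ a]` -/
def eG₂ (a : Finset (Fin m)) (i : Fin m) : Fin n :=
  ⟨f + 2 * m + 2 * (i : ℕ) + (if i ∈ a then 0 else 1), by have := i.2; split_ifs <;> omega⟩

/-- column embedding: `i ↦ f + 2i + 1` -/
def eC (i : Fin m) : Fin n := ⟨f + 2 * (i : ℕ) + 1, by have := i.2; omega⟩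

theorem eF_val (i : Fin f) : ((eF hn i : Fin n) : ℕ) = i := rfl
theorem eG₁_val (a : Finset (Fin m)) (i : Fin m) :
    ((eG₁ hn a i : Fin n) : ℕ) = f + 2 * (i : ℕ) + (if i ∈ a then 1 else 0) := rfl
theorem eG₂_val (a : Finset (Fin m)) (i : Fin m) :
    ((eG₂ hn a i : Fin n) : ℕ) = f + 2 * m + 2 * (i : ℕ) + (if i ∈ a then 0 else 1) := rfl
theorem eC_val (i : Fin m) : ((eC hn i : Fin n) : ℕ) = f + 2 * (i : ℕ) + 1 := rfl

theorem eF_injective : Function.Injective (eF (n := n) (m := m) hn) := fun i j h => by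
  have e := congrArg Fin.val h
  rw [eF_val, eF_val] at e
  exact Fin.ext e

theorem eG₁_injective (a : Finset (Fin m)) : Function.Injective (eG₁ hn a) := fun i j h => by
  have e := congrArg Fin.val h
  rw [eG₁_val, eG₁_val] at e
  apply Fin.ext
  split_ifs at e <;> omega

theorem eG₂_injective (a : Finset (Fin m)) : Function.Injective (eG₂ hn a) := fun i j h => by
  have e := congrArg Fin.val h
  rw [eG₂_val, eG₂_val] at e
  apply Fin.ext
  split_ifs at e <;> omega

theorem eC_injective : Function.Injective (eC (n := n) hn) := fun i j h => by
  have e := congrArg Fin.val h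
  rw [eC_val, eC_val] at e
  exact Fin.ext (by omega)

/-- the three position groups and the row / column embeddings -/
def vF : Finset (Fin n) := univ.image (eF (m := m) hn)
def vG₁ (a : Finset (Fin m)) : Finset (Fin n) := univ.image (eG₁ hn a)
def vG₂ (a : Finset (Fin m)) : Finset (Fin n) := univ.image (eG₂ hn a)
/-- ★ the row `A_a = [0,f) ∪ {f + 2i + [i ∈ a]} ∪ {f + 2m + 2i + [i ∉ a]}` -/
def vRow (a : Finset (Fin m)) : Finset (Fin n) := vF hn ∪ (vG₁ hn a ∪ vG₂ hn a)
/-- ★ the column `B_b = {f + 2i + 1 : i ∈ b}` -/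
def vCol (b : Finset (Fin m)) : Finset (Fin n) := b.image (eC hn)

theorem disjoint_vF (a : Finset (Fin m)) : Disjoint (vF hn) (vG₁ hn a ∪ vG₂ hn a) := by
  rw [disjoint_left]
  intro p hp hq
  unfold vF at hp
  obtain ⟨x, _, rfl⟩ := mem_image.1 hp
  have hx := x.2
  rcases mem_union.1 hq with h | h
  · unfold vG₁ at h
    obtain ⟨y, _, hy⟩ := mem_image.1 h
    have e := congrArg Fin.val hy
    rw [eG₁_val, eF_val] at e
    split_ifs at e <;> omega
  · unfold vG₂ at h
    obtain ⟨y, _, hy⟩ := mem_image.1 h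
    have e := congrArg Fin.val hy
    rw [eG₂_val, eF_val] at e
    split_ifs at e <;> omega

theorem disjoint_vG (a : Finset (Fin m)) : Disjoint (vG₁ hn a) (vG₂ hn a) := by
  rw [disjoint_left]
  intro p hp hq
  unfold vG₁ at hp
  unfold vG₂ at hq
  obtain ⟨x, _, rfl⟩ := mem_image.1 hp
  obtain ⟨y, _, hy⟩ := mem_image.1 hq
  have hx := x.2
  have e := congrArg Fin.val hy
  rw [eG₂_val, eG₁_val] at e
  split_ifs at e <;> omega

/-- `|A_a| = f + 2m = k` -/
theorem vRow_card (a : Finset (Fin m)) : (vRow hn a).card = f + 2 * m := by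
  rw [vRow, card_union_of_disjoint (disjoint_vF hn a), card_union_of_disjoint (disjoint_vG hn a)]
  unfold vF vG₁ vG₂
  rw [card_image_of_injective _ (eF_injective hn), card_image_of_injective _ (eG₁_injective hn a),
    card_image_of_injective _ (eG₂_injective hn a)]
  simp only [card_univ, Fintype.card_fin]
  omega

/-- `A_a ∩ B_b` is the image of `a ∩ b` -/
theorem vRow_inter_vCol (a b : Finset (Fin m)) : vRow hn a ∩ vCol hn b = (a ∩ b).image (eC hn) := by
  ext p
  rw [mem_inter]
  constructor
  · rintro ⟨hr, hc⟩
    unfold vCol at hc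
    obtain ⟨i, hib, rfl⟩ := mem_image.1 hc
    have hi := i.2
    rw [vRow, mem_union, mem_union] at hr
    rcases hr with h | h | h
    · unfold vF at h
      obtain ⟨x, _, hx⟩ := mem_image.1 h
      have e := congrArg Fin.val hx
      rw [eF_val, eC_val] at e
      have := x.2
      omega
    · unfold vG₁ at h
      obtain ⟨x, _, hx⟩ := mem_image.1 h
      have e := congrArg Fin.val hx
      rw [eG₁_val, eC_val] at e
      by_cases hxa : x ∈ a
      · rw [if_pos hxa] at e
        have hxi : x = i := Fin.ext (by omega)
        subst hxi
        exact mem_image.2 ⟨x, mem_inter.2 ⟨hxa, hib⟩, rfl⟩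
      · rw [if_neg hxa] at e
        omega
    · unfold vG₂ at h
      obtain ⟨x, _, hx⟩ := mem_image.1 h
      have e := congrArg Fin.val hx
      rw [eG₂_val, eC_val] at e
      split_ifs at e <;> omega
  · intro hp
    obtain ⟨i, hi, rfl⟩ := mem_image.1 hp
    rw [mem_inter] at hi
    refine ⟨?_, ?_⟩
    · rw [vRow, mem_union, mem_union]
      refine Or.inr (Or.inl ?_)
      unfold vG₁
      refine mem_image.2 ⟨i, mem_univ _, Fin.ext ?_⟩
      rw [eG₁_val, eC_val, if_pos hi.1]
    · unfold vCol
      exact mem_image.2 ⟨i, hi.2, rfl⟩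

/-- `|A_a ∩ B_b| = |a ∩ b|` -/
theorem vRow_inter_vCol_card (a b : Finset (Fin m)) : (vRow hn a ∩ vCol hn b).card = (a ∩ b).card := by
  rw [vRow_inter_vCol, card_image_of_injective _ (eC_injective hn)]

theorem gauss (f : ℕ) : ∑ i ∈ range f, ((i : ℕ) : ℝ) = (f : ℝ) * (f - 1) / 2 := by
  induction f with
  | zero => simp
  | succ f ih => rw [sum_range_succ, ih]; push_cast; ring

theorem vF_sum : ∑ p ∈ vF (m := m) hn, ((p : ℕ) : ℝ) = (f : ℝ) * (f - 1) / 2 := by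
  unfold vF
  rw [sum_image (eF_injective hn).injOn]
  show ∑ i : Fin f, (((i : ℕ) : ℝ)) = _
  rw [Fin.sum_univ_eq_sum_range (fun i => ((i : ℕ) : ℝ)) f, gauss]

theorem vG_sum (a : Finset (Fin m)) :
    ∑ p ∈ vG₁ hn a, ((p : ℕ) : ℝ) + ∑ p ∈ vG₂ hn a, ((p : ℕ) : ℝ) =
      (m : ℝ) * (2 * f + 2 * m + 1) + 2 * ((m : ℝ) * (m - 1)) := by
  unfold vG₁ vG₂
  rw [sum_image (eG₁_injective hn a).injOn, sum_image (eG₂_injective hn a).injOn, ← sum_add_distrib]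
  have hpt : ∀ i : Fin m, (((eG₁ hn a i : Fin n) : ℕ) : ℝ) + (((eG₂ hn a i : Fin n) : ℕ) : ℝ)
      = (2 * (f : ℝ) + 2 * m + 1) + 4 * ((i : ℕ) : ℝ) := by
    intro i
    rw [eG₁_val, eG₂_val]
    split_ifs <;> push_cast <;> ring
  rw [sum_congr rfl (fun i _ => hpt i), sum_add_distrib, sum_const, card_univ, Fintype.card_fin, nsmul_eq_mul,
    ← mul_sum, Fin.sum_univ_eq_sum_range (fun i => ((i : ℕ) : ℝ)) m, gauss]
  ring

/-- the pedestal of every embedded row is `2m²`: `ΣA_a = k(k−1)/2 + 2m²`, `k = f + 2m` -/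
theorem vRow_sum (a : Finset (Fin m)) :
    ∑ p ∈ vRow hn a, ((p : ℕ) : ℝ) = ((f + 2 * m : ℕ) : ℝ) * (((f + 2 * m : ℕ) : ℝ) - 1) / 2 + 2 * (m : ℝ) ^ 2 := by
  rw [vRow, sum_union (disjoint_vF hn a), sum_union (disjoint_vG hn a), vF_sum, vG_sum]
  push_cast
  ring

open Literature.Combinatorics.Optimization (HasNonnegFactorization udisjShift_nonnegRank_explicit)

include hn in
/-- ★★ **ONE BLOCK SEES `UDISJ` (the `n`-free term of ★ is necessary).**  If `f + 4m ≤ n`, `4j + 3 ≤ m`, `0 ≤ λ` and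
`λ·m² ≤ 1/2`, then every nonnegative factorisation of the `(f+2m)`-slice of `M̄_{λ,f+2m}` through `N` slots has
`e^{(j+1)/576} ≤ 64 (j+1) N`.  Proof: the rows `A_a`, columns `B_b` above realise the `ρ`-extension `(1 − |a∩b|)² + 2λm²` of `UDISJ_m`
(`vRow_inter_vCol_card`, `vRow_sum`), `ρ = 1 + 2λm² ∈ [1,2]`, then BFPS 2012 Theorem 5 as discharged in the tree.
[cite: BraunEtAl2012, Thm 5 (§3.2, pp. 11–12)] -/
theorem singleBlock_visible_split {j : ℕ} (hj : 4 * j + 3 ≤ m) (lam : ℝ) (hlam : 0 ≤ lam)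
    (hsmall : lam * (m : ℝ) ^ 2 ≤ 1 / 2) {N : ℕ}
    (h : HasNonnegFactorization (pencilBarSlice n lam (f + 2 * m)) N) :
    Real.exp ((j + 1 : ℝ) / 576) ≤ 64 * (j + 1) * N := by
  classical
  obtain ⟨U, V, hU, hV, hM⟩ := h
  set ρ : ℝ := 1 + 2 * lam * (m : ℝ) ^ 2 with hρ
  have hρ1 : 1 ≤ ρ := by rw [hρ]; nlinarith
  have hρ2 : ρ ≤ 2 := by rw [hρ]; nlinarith
  have hjm : 4 * j + 3 ≤ Fintype.card (Fin m) := by rwa [Fintype.card_fin]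
  have key := udisjShift_nonnegRank_explicit (α := Fin m) hjm hρ1
    (fun a b => ((1 : ℝ) - ((a ∩ b).card : ℝ)) ^ 2 + 2 * lam * (m : ℝ) ^ 2)
    (fun a b hab => by
      rw [Finset.disjoint_iff_inter_eq_empty.1 hab, Finset.card_empty, hρ]; push_cast; ring)
    (fun a b hab => by rw [hab, hρ]; push_cast; ring)
    (fun a s => U ⟨vRow hn a, vRow_card hn a⟩ s)
    (fun b s => V s (vCol hn b))
    (fun a s => hU _ _) (fun b s => hV _ _)
    (fun a b => by
      have h1 := hM ⟨vRow hn a, vRow_card hn a⟩ (vCol hn b)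
      unfold pencilBarSlice pencilBar at h1
      dsimp only at h1
      rw [vRow_inter_vCol_card, vRow_sum] at h1
      rw [← h1]
      push_cast
      ring)
  have hexp : Real.exp ((j + 1 : ℝ) / 576) ≤ Real.exp ((j + 1 : ℝ) / (144 * ρ ^ 2)) := by
    apply Real.exp_le_exp.2
    have h144 : 144 * ρ ^ 2 ≤ 576 := by nlinarith
    exact div_le_div_of_nonneg_left (by positivity) (by positivity) h144
  have hN0 : (0 : ℝ) ≤ N := by positivity
  calc Real.exp ((j + 1 : ℝ) / 576) ≤ Real.exp ((j + 1 : ℝ) / (144 * ρ ^ 2)) := hexp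
    _ ≤ 32 * (j + 1) * ρ * Fintype.card (Fin N) := key
    _ ≤ 32 * (j + 1) * 2 * N := by rw [Fintype.card_fin]; gcongr
    _ = 64 * (j + 1) * N := by ring

end Visible

open Literature.Combinatorics.Optimization (HasNonnegFactorization)

/-- ★★ the same on an arbitrary slice `k` with room `2m ≤ k`, `k + 2m ≤ n`: `rank₊ M̄_{λ,k} ≥ e^{(j+1)/576} / (64(j+1))` for
`4j+3 ≤ m`, `λm² ≤ 1/2` — i.e. `rank₊ M̄_{λ,k} ≥ 2^{Ω(min(k/2, (n−k)/2, (2λ)^{−1/2}))}`, an `n`-free lower companion of ★. -/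
theorem singleBlock_visible {n k m j : ℕ} (h2m : 2 * m ≤ k) (hkn : k + 2 * m ≤ n) (hj : 4 * j + 3 ≤ m)
    (lam : ℝ) (hlam : 0 ≤ lam) (hsmall : lam * (m : ℝ) ^ 2 ≤ 1 / 2) {N : ℕ}
    (h : HasNonnegFactorization (pencilBarSlice n lam k) N) :
    Real.exp ((j + 1 : ℝ) / 576) ≤ 64 * (j + 1) * N := by
  obtain ⟨f, rfl⟩ : ∃ f, k = f + 2 * m := ⟨k - 2 * m, by omega⟩
  exact singleBlock_visible_split (by omega) hj lam hlam hsmall h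

end

end Summit.ValiantsHypothesis.ValiantsHypothesis.Cruxes.NNDivisionHard.SingleBlock39
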